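import Literature.RepresentationTheory.BorelWallach2000.TrivialModuleGKCohomologyUnitary   -- ★ `upq_star_mem_lie` (𝔲(α, β) is `θ`-stable)
import HarnessLib

/-!
# The Cartan decomposition `𝔲(α, β) = 𝔨 + 𝔭` spans (ROAD-GLOB v1.1, brick Φ3-b)

For the real linear group `G = U(α, β)` (★ `uFormGroup α β`) with Lie algebra `𝔤 = 𝔲(α, β) ≤ M_{α ⊕ β}(ℂ)` (a real Lie subalgebra, stable under
the conjugate transpose by ★ `upq_star_mem_lie`) and `𝔨 = 𝔤 ∩ 𝔲(N)` the skew-hermitian part (★ `RealMatrixGroup.compactLie`,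
★ `mem_compactLie_iff`), every `X ∈ 𝔤` is `X = ½(X − Xᴴ) + ½(X + Xᴴ)` with `X − Xᴴ ∈ 𝔨` and `X + Xᴴ ∈ 𝔭 := {X ∈ 𝔤 | Xᴴ = X}`; so the real
span of `𝔨 ∪ 𝔭` inside `𝔤` is everything:
`upq_span_compactLie_union_herm_eq_top : Submodule.span ℝ (range (𝔨 ↪ 𝔤) ∪ {X : 𝔤 | Xᴴ = X}) = ⊤`.
This is the spanning-set hypothesis `hS` (with `S = 𝔨 ∪ 𝔭`) of ★ `isUnitaryGlobalization_of_recognition` (brick «H»,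
`UnitaryGlobalizationRecognition`) in the A6 (#92) road of the cell `hodgecm-mathlib` (LEAD F0P3b-p01 (g3), 2026-08-31); theorems only, no
definition, no named fact, no instance; `--supports stmt-HodgeConjecture-24833`.  HC_CM is proved only modulo the printed citations until rung 0
closes.  [Knapp2002, VI §2 (6.24)–(6.26): `𝔤₀ = 𝔨₀ ⊕ 𝔭₀` for the Cartan involution `θ X = −Xᴴ`] [BorelWallach2000, II §1.1 (3)].

## References
* [Knapp2002] A. Knapp, *Lie groups beyond an introduction*, VI §2.  * [BorelWallach2000] II §1.1.
-/

set_option autoImplicit false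

noncomputable section

-- as in ★ `RealMatrixGroups` ∕ `JunctionLinearRealGroup`: the commutator Lie ring on matrices is a local instance in this tree
attribute [local instance 100] LieRing.ofAssociativeRing

open scoped Matrix MatrixGroups ComplexConjugate

namespace Literature.NumberTheory.Automorphic

open Literature.RepresentationTheory.KonnoKonno2007 Literature.RepresentationTheory.BorelWallach2000

variable {α β : Type*} [Fintype α] [DecidableEq α] [Fintype β] [DecidableEq β]

/-- The conjugate transpose of `X ∈ 𝔲(α, β)` as an element of `𝔲(α, β)` (★ `upq_star_mem_lie`), written `θ`-style.
[cite: BorelWallach2000, II §1.1 (3)] -/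
theorem upq_star_coe_mem_lie (X : (uFormGroup α β).lie) :
    star (X : Matrix (α ⊕ β) (α ⊕ β) ℂ) ∈ (uFormGroup α β).lie :=
  upq_star_mem_lie _ X.2

/-- **`X − Xᴴ ∈ 𝔨`** for `X ∈ 𝔲(α, β)`: it lies in `𝔤` and is skew-hermitian. [cite: Knapp2002, VI §2 (6.24)] -/
theorem upq_sub_star_mem_compactLie (X : (uFormGroup α β).lie) :
    (X : Matrix (α ⊕ β) (α ⊕ β) ℂ) - star (X : Matrix (α ⊕ β) (α ⊕ β) ℂ) ∈ (uFormGroup α β).compactLie := by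
  rw [RealMatrixGroup.mem_compactLie_iff]
  refine ⟨(uFormGroup α β).lie.sub_mem X.2 (upq_star_coe_mem_lie X), ?_⟩
  rw [star_sub, star_star, neg_sub]

/-- **`X + Xᴴ` is hermitian** (and lies in `𝔤`). [cite: Knapp2002, VI §2 (6.24)] -/
theorem upq_add_star_conjTranspose (X : (uFormGroup α β).lie) :
    ((X : Matrix (α ⊕ β) (α ⊕ β) ℂ) + star (X : Matrix (α ⊕ β) (α ⊕ β) ℂ))ᴴ =
      (X : Matrix (α ⊕ β) (α ⊕ β) ℂ) + star (X : Matrix (α ⊕ β) (α ⊕ β) ℂ) := by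
  rw [← Matrix.star_eq_conjTranspose, star_add, star_star, add_comm]

/-- **THE CARTAN DECOMPOSITION SPANS: `𝔲(α, β) = 𝔨 + 𝔭`** — the real span, inside `𝔤 = 𝔲(α, β)`, of the image of `𝔨 = 𝔤 ∩ 𝔲(N)` together with the
hermitian elements `𝔭 = {X ∈ 𝔤 | Xᴴ = X}` is all of `𝔤` (`X = ½(X − Xᴴ) + ½(X + Xᴴ)`).  The `hS` of ★ `isUnitaryGlobalization_of_recognition` with
`S = 𝔨 ∪ 𝔭`. [cite: Knapp2002, VI §2 (6.24)–(6.26)] [cite: BorelWallach2000, II §1.1 (3)] -/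
theorem upq_span_compactLie_union_herm_eq_top :
    Submodule.span ℝ
        (Set.range (fun Y : (uFormGroup α β).compactLie =>
            (LieSubalgebra.inclusion (uFormGroup α β).compactLie_le_lie Y : (uFormGroup α β).lie)) ∪
          {X : (uFormGroup α β).lie | ((X : Matrix (α ⊕ β) (α ⊕ β) ℂ))ᴴ = X}) = ⊤ := by
  refine Submodule.eq_top_iff'.2 fun X => ?_
  -- the two halves, as elements of `𝔤`
  let K : (uFormGroup α β).lie :=
    ⟨(X : Matrix (α ⊕ β) (α ⊕ β) ℂ) - star (X : Matrix (α ⊕ β) (α ⊕ β) ℂ),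
      (uFormGroup α β).lie.sub_mem X.2 (upq_star_coe_mem_lie X)⟩
  let P : (uFormGroup α β).lie :=
    ⟨(X : Matrix (α ⊕ β) (α ⊕ β) ℂ) + star (X : Matrix (α ⊕ β) (α ⊕ β) ℂ),
      (uFormGroup α β).lie.add_mem X.2 (upq_star_coe_mem_lie X)⟩
  have hK : K ∈ Submodule.span ℝ
      (Set.range (fun Y : (uFormGroup α β).compactLie =>
          (LieSubalgebra.inclusion (uFormGroup α β).compactLie_le_lie Y : (uFormGroup α β).lie)) ∪
        {X : (uFormGroup α β).lie | ((X : Matrix (α ⊕ β) (α ⊕ β) ℂ))ᴴ = X}) := by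
    refine Submodule.subset_span (Or.inl ⟨⟨_, upq_sub_star_mem_compactLie X⟩, ?_⟩)
    exact Subtype.ext rfl
  have hP : P ∈ Submodule.span ℝ
      (Set.range (fun Y : (uFormGroup α β).compactLie =>
          (LieSubalgebra.inclusion (uFormGroup α β).compactLie_le_lie Y : (uFormGroup α β).lie)) ∪
        {X : (uFormGroup α β).lie | ((X : Matrix (α ⊕ β) (α ⊕ β) ℂ))ᴴ = X}) :=
    Submodule.subset_span (Or.inr (upq_add_star_conjTranspose X))
  -- `X = ½ K + ½ P`
  have hX : X = (1 / 2 : ℝ) • K + (1 / 2 : ℝ) • P := by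
    apply Subtype.ext
    show (X : Matrix (α ⊕ β) (α ⊕ β) ℂ) =
      (1 / 2 : ℝ) • ((X : Matrix (α ⊕ β) (α ⊕ β) ℂ) - star (X : Matrix (α ⊕ β) (α ⊕ β) ℂ)) +
        (1 / 2 : ℝ) • ((X : Matrix (α ⊕ β) (α ⊕ β) ℂ) + star (X : Matrix (α ⊕ β) (α ⊕ β) ℂ))
    rw [← smul_add, sub_add_add_cancel, ← two_smul ℝ (X : Matrix (α ⊕ β) (α ⊕ β) ℂ), smul_smul]
    norm_num
  rw [hX]
  exact Submodule.add_mem _ (Submodule.smul_mem _ _ hK) (Submodule.smul_mem _ _ hP)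

end Literature.NumberTheory.Automorphic

end
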